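import Summits.QuantumFields.BalabanUV.T4Continuum.Support.OutputRateComplexSlice

/-!
# OutputRateComplexSliceWitness — two NECESSITY witnesses for the placement of the two-constants junction on Road D (R49 (4)):
# (W-i) a rate at the BASE real point alone gives no rate at complex points; (W-ii) the junction cannot be moved from the INPUT
# operators to the OUTPUT tables (the renewal inequality with exponent loss does not close)

Cell `pub-balaban`, unit `b2b-balaban-t4-ne5-p1` (row NE5 OWNER, gen 36; owner item «g36-b», `HOME/CLAIMS.log` l.18137).  Summits-side NEW
WORK under the LEAN PLACEMENT RULE ([folklore] toy witnesses; nothing printed is asserted; no `[cite:]`; no `Prop`-valued fact minted; 0 `def` — the toy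
families and the toy sequence are exhibited INSIDE existential statements).  HONEST FRAMING: rung (B)+1 of the FINITE-VOLUME T⁴
continuum programme — NOT infinite volume, NOT a mass gap, NOT the Clay problem, NOT a proof of NE5 (NOT PRINTED; GAPS G-t4-U3-1), and NOT a
refutation of anything: non-circularity ∕ necessity controls in the style of `OutputRateInsertionWitness`, `T4InputCauchyRateSharp.sharp_ne5_iff`.
HONEST DEPENDENCY (cell, verbatim): continuum YM on T⁴ ⇐ BetaPertH ∧ nine spine estimates (0/9 proved); BetaPertH ⇐ (D1) ∧ (D4) ∧ CAP+tail;
G-an2-4 gates asym, D1 and NE2/3/4.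

WHY.  On Road D (R49) the renewal recursion of route P1 runs on the COMPLEX small-field chart (the history insertion [II] (1.23) reads the
earlier terms at complex configurations), so the W1 binder is consumed at complex chart points; `OutputRateComplexSlice` (p225933) produces
it there from the rate on a REAL WINDOW (the real diameters of the slices) by the two-constants theorem, ONCE, on operator data.  Two design
questions were asked (Q-NE23-W; substrate (λ17); `NE5-VERDICT.md` §11): (i) can the real window be shrunk to the charted real points
themselves (the image of the section `ι`) — i.e. is «W1 at the real base point of each slice» enough?  (ii) can the interpolation be done on
the OUTPUTS instead (run the recursion on real points only and interpolate the output discrepancy `D_j` to the complex points level by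
level), which would consume rows NE2 ∕ NE3 literally at the charted real points?  Both answers are NO, and this module records why with
kernel-checked toys:
* (W-i) the difference family `D k z = M·z` on the chart `ℂ` (slice `γ = id`): it VANISHES at the base point `0` at every level (rate
  hypothesis with `δ = 0`), is entire and bounded by `M` on the closed unit disc (the slice letters), yet at the chart point `I·r` (depth
  `r`) it has norm `M·r` at EVERY level — no bound `C·θ′^k` with `θ′ < 1` (`basePoint_no_rate`).  So p225933's hypothesis «rate on the whole real
  DIAMETER» cannot be weakened to the base point: (M1-real⁺)'s real window — a real neighbourhood of the charted real points of real radius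
  comparable to the chart's imaginary depth (any radius `> depth` works, at the price `λ(r) → 1`) — is NECESSARY on the slice road.
* (W-ii) interpolating the OUTPUT discrepancy would turn the kernel's LINEAR renewal inequality `D_{k+1} ≤ a·θ^k + b·Σ ω^{k−j}·D_j`
  (`T4InputCauchyRate.ne5_of_recursiveRate`, which closes geometrically under `ω + b < θ′`) into one with EXPONENT LOSS,
  `D_{k+1} ≤ a·θ^k + b·(D_k)^{1−λ}·M^{λ}`; its model solution (`x₀ = 1`, `x_{k+1} = b·x_k^{1−λ}`; `a = 0`, `M = 1`) is bounded BELOW by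
  `min 1 b^{1∕λ} > 0` for EVERY `b > 0`, `0 < λ ≤ 1` (`floor_of_lossRenewal`) — no geometric rate however small the feedback constant
  (`lossRenewal_no_rate`).  Hence the junction must sit on the INPUT operators (no recursion) and the recursion must run on the complex chart —
  R49 (4)'s placement is forced, not a convenience.
WHAT IS NOT HERE.  No instance, no estimate of [II], nothing about rows NE2 ∕ NE3's actual carriers (whether their rates are typed
background-generically on the real window is Q-NE23-W, theirs and the substrate's).  0 sorry; axioms ⊆ {propext, Classical.choice, Quot.sound}.
-/

noncomputable section

open Complex Set Metric Real Filter Topology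

namespace Summit.QuantumFields.BalabanUV.T4Continuum.OutputRateComplexSliceWitness

/-! ## §0 Two pieces of arithmetic -/

/-- [folklore] A sequence with a POSITIVE FLOOR has no geometric rate: if `0 < m ≤ y k` for all `k` then there are no `C`, `ρ < 1` with
`y k ≤ C·ρ^k` for all `k`. -/
theorem no_rate_of_floor {y : ℕ → ℝ} {m : ℝ} (hm : 0 < m) (hy : ∀ k, m ≤ y k) :
    ¬ ∃ C ρ : ℝ, ρ < 1 ∧ ∀ k : ℕ, y k ≤ C * ρ ^ k := by
  rintro ⟨C, ρ, hρ, h⟩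
  have h' : ∀ k : ℕ, m ≤ C * ρ ^ k := fun k => (hy k).trans (h k)
  have hC : m ≤ C := by simpa using h' 0
  have hCpos : 0 < C := hm.trans_le hC
  rcases le_or_gt ρ 0 with hρ0 | hρ0
  · have h1 := h' 1
    rw [pow_one] at h1
    nlinarith
  · have ht : Tendsto (fun k : ℕ => C * ρ ^ k) atTop (𝓝 (C * 0)) :=
      (tendsto_pow_atTop_nhds_zero_of_lt_one hρ0.le hρ).const_mul C
    rw [mul_zero] at ht
    obtain ⟨k, hk⟩ := (ht.eventually (gt_mem_nhds hm)).exists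
    exact absurd (h' k) (not_le.mpr hk)

/-- [folklore] `m = m^{l}·m^{1−l}` for `m > 0`. -/
theorem rpow_split {m : ℝ} (hm : 0 < m) (l : ℝ) : m = m ^ l * m ^ (1 - l) := by
  rw [← Real.rpow_add hm]; norm_num

/-! ## §1 (W-i) A rate at the base real point alone gives no rate at complex points -/

/-- [folklore] **(W-i) NO RATE AT COMPLEX POINTS FROM THE BASE POINT ALONE.**  For every bound letter `M > 0` and depth `0 < r` there is a
level-indexed family `D k : ℂ → ℂ` (read: the DIFFERENCE of the two runs' operator data along one slice `γ = id` of the chart `ℂ`; here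
`D k z = M·z` at every level) such that (a) the two-spacing rate hypothesis holds AT THE REAL BASE POINT `0` with `δ = 0` at every level,
(b) the slice letters of `OutputRateComplexSlice.operatorRate_complex_of_realSlice` hold — `D k` holomorphic in the open unit disc, continuous
on the closed disc, bounded there by `M` —, (c) the chart point `I·r` has depth `r`, and yet (d) there are NO `C`, `θ′ < 1` with
`‖D k (I·r)‖ ≤ C·θ′^k` for all `k` (indeed `‖D k (I·r)‖ = M·r` at every level).  So p225933's hypothesis `hreal` on the whole real
DIAMETER of each slice cannot be weakened to the slice's real base point: on the slice road a real WINDOW is necessary ((M1-real⁺)). -/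
theorem basePoint_no_rate {M r : ℝ} (hM : 0 < M) (hr : 0 < r) :
    ∃ D : ℕ → ℂ → ℂ,
      (∀ k, ‖D k 0‖ ≤ 0) ∧
      (∀ k, DiffContOnCl ℂ (D k) (ball 0 1) ∧ ∀ z : ℂ, ‖z‖ ≤ 1 → ‖D k z‖ ≤ M) ∧
      ‖(I * r : ℂ)‖ = r ∧
      (∀ k, ‖D k (I * r)‖ = M * r) ∧
      ¬ ∃ C θ' : ℝ, θ' < 1 ∧ ∀ k : ℕ, ‖D k (I * r)‖ ≤ C * θ' ^ k := by
  have hnorm : ∀ z : ℂ, ‖(M : ℂ) * z‖ = M * ‖z‖ := fun z => by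
    rw [norm_mul, Complex.norm_real, Real.norm_eq_abs, abs_of_nonneg hM.le]
  have hIr : ‖(I * r : ℂ)‖ = r := by
    rw [norm_mul, Complex.norm_I, Complex.norm_real, Real.norm_eq_abs, abs_of_nonneg hr.le, one_mul]
  have hval : ∀ k : ℕ, ‖(M : ℂ) * (I * r)‖ = M * r := fun _ => by rw [hnorm, hIr]
  refine ⟨fun _ z => (M : ℂ) * z, fun k => by simp, fun k => ⟨?_, fun z hz => ?_⟩, hIr, hval, ?_⟩
  · exact (differentiable_id.const_mul (M : ℂ)).diffContOnCl
  · rw [hnorm]; exact mul_le_of_le_one_right hM.le hz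
  · exact no_rate_of_floor (m := M * r) (mul_pos hM hr) fun k => (hval k).ge

/-! ## §2 (W-ii) The renewal inequality with exponent loss does not close -/

/-- [folklore] **THE LOWER BARRIER.**  Any positive sequence obeying the loss recursion from below, `b·x_k^{1−λ} ≤ x_{k+1}`, and starting above
the floor `min 1 b^{1∕λ}`, stays above it (`b > 0`, `0 < λ ≤ 1`): the fixed point `b^{1∕λ}` of `x ↦ b·x^{1−λ}` repels nothing downwards. -/
theorem floor_of_lossRenewal {b l : ℝ} (hb : 0 < b) (hl0 : 0 < l) (hl1 : l ≤ 1) {x : ℕ → ℝ} (hpos : ∀ k, 0 < x k)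
    (h0 : min 1 (b ^ (1 / l)) ≤ x 0) (hrec : ∀ k, b * x k ^ (1 - l) ≤ x (k + 1)) : ∀ k, min 1 (b ^ (1 / l)) ≤ x k
  | 0 => h0
  | k + 1 => by
    set m : ℝ := min 1 (b ^ (1 / l)) with hm
    have hmpos : 0 < m := lt_min one_pos (Real.rpow_pos_of_pos hb _)
    have ih : m ≤ x k := floor_of_lossRenewal hb hl0 hl1 hpos h0 hrec k
    have hml : m ^ l ≤ b := by
      calc m ^ l ≤ (b ^ (1 / l)) ^ l := Real.rpow_le_rpow hmpos.le (min_le_right _ _) hl0.le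
        _ = b := by rw [← Real.rpow_mul hb.le, one_div_mul_cancel hl0.ne', Real.rpow_one]
    calc m = m ^ l * m ^ (1 - l) := rpow_split hmpos l
      _ ≤ b * m ^ (1 - l) := mul_le_mul_of_nonneg_right hml (Real.rpow_nonneg hmpos.le _)
      _ ≤ b * x k ^ (1 - l) := mul_le_mul_of_nonneg_left (Real.rpow_le_rpow hmpos.le ih (by linarith)) hb.le
      _ ≤ x (k + 1) := hrec k

/-- [folklore] **THE UPPER BARRIER** (the model solutions are honest bounded discrepancies, not blow-ups): a positive sequence with
`x_{k+1} ≤ b·x_k^{1−λ}` starting below `max 1 b^{1∕λ}` stays below it. -/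
theorem ceiling_of_lossRenewal {b l : ℝ} (hb : 0 < b) (hl0 : 0 < l) (hl1 : l ≤ 1) {x : ℕ → ℝ} (hpos : ∀ k, 0 < x k)
    (h0 : x 0 ≤ max 1 (b ^ (1 / l))) (hrec : ∀ k, x (k + 1) ≤ b * x k ^ (1 - l)) : ∀ k, x k ≤ max 1 (b ^ (1 / l))
  | 0 => h0
  | k + 1 => by
    set m : ℝ := max 1 (b ^ (1 / l)) with hm
    have hmpos : 0 < m := lt_max_of_lt_left one_pos
    have ih : x k ≤ m := ceiling_of_lossRenewal hb hl0 hl1 hpos h0 hrec k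
    have hml : b ≤ m ^ l := by
      calc b = (b ^ (1 / l)) ^ l := by rw [← Real.rpow_mul hb.le, one_div_mul_cancel hl0.ne', Real.rpow_one]
        _ ≤ m ^ l := Real.rpow_le_rpow (Real.rpow_nonneg hb.le _) (le_max_right _ _) hl0.le
    calc x (k + 1) ≤ b * x k ^ (1 - l) := hrec k
      _ ≤ b * m ^ (1 - l) := mul_le_mul_of_nonneg_left (Real.rpow_le_rpow (hpos k).le ih (by linarith)) hb.le
      _ ≤ m ^ l * m ^ (1 - l) := mul_le_mul_of_nonneg_right hml (Real.rpow_nonneg hmpos.le _)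
      _ = m := (rpow_split hmpos l).symm

/-- [folklore] **(W-ii) NO GEOMETRIC RATE UNDER EXPONENT LOSS.**  For every feedback constant `b > 0` (however small) and loss `0 < λ ≤ 1`
there is a positive, bounded sequence `x` with `x₀ = 1` satisfying the renewal recursion WITH EXPONENT LOSS and zero source,
`x_{k+1} = b·x_k^{1−λ}` (so a fortiori the inequality `D_{k+1} ≤ a·θ^k + b·D_k^{1−λ}·M^{λ}` with `a = 0`, `M = 1`), which is bounded BELOW by
`min 1 b^{1∕λ} > 0` and therefore admits NO bound `C·ρ^k` with `ρ < 1`.  Contrast: the kernel's LINEAR renewal (`λ = 0`,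
`T4InputCauchyRate.ne5_of_recursiveRate`) closes at rate `θ′` whenever `ω + b < θ′`.  Hence on Road D the two-constants interpolation
(which costs exactly such an exponent `λ(r) > 0`) must be applied ONCE to the INPUT operator data — where there is no recursion — and not
to the output tables inside the recursion: R49 (4)'s placement is forced. -/
theorem lossRenewal_no_rate {b l : ℝ} (hb : 0 < b) (hl0 : 0 < l) (hl1 : l ≤ 1) :
    ∃ x : ℕ → ℝ, (∀ k, 0 < x k) ∧ x 0 = 1 ∧ (∀ k, x (k + 1) = b * x k ^ (1 - l)) ∧
      (∀ k, min 1 (b ^ (1 / l)) ≤ x k) ∧ (∀ k, x k ≤ max 1 (b ^ (1 / l))) ∧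
      ¬ ∃ C ρ : ℝ, ρ < 1 ∧ ∀ k : ℕ, x k ≤ C * ρ ^ k := by
  let x : ℕ → ℝ := fun k => Nat.rec (motive := fun _ => ℝ) 1 (fun _ y => b * y ^ (1 - l)) k
  have hx0 : x 0 = 1 := rfl
  have hrec : ∀ k, x (k + 1) = b * x k ^ (1 - l) := fun _ => rfl
  have hpos : ∀ k, 0 < x k := by
    intro k
    induction k with
    | zero => rw [hx0]; exact one_pos
    | succ k ih => rw [hrec]; exact mul_pos hb (Real.rpow_pos_of_pos ih _)
  have hfloor : ∀ k, min 1 (b ^ (1 / l)) ≤ x k :=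
    floor_of_lossRenewal hb hl0 hl1 hpos (by rw [hx0]; exact min_le_left _ _) fun k => (hrec k).ge
  have hceil : ∀ k, x k ≤ max 1 (b ^ (1 / l)) :=
    ceiling_of_lossRenewal hb hl0 hl1 hpos (by rw [hx0]; exact le_max_left _ _) fun k => (hrec k).le
  exact ⟨x, hpos, hx0, hrec, hfloor, hceil,
    no_rate_of_floor (lt_min one_pos (Real.rpow_pos_of_pos hb _)) hfloor⟩

end Summit.QuantumFields.BalabanUV.T4Continuum.OutputRateComplexSliceWitness

end
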